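import Mathlib.GroupTheory.QuotientGroup.Basic
import Literature.IUT.HodgeTheaters.InitialThetaDataLocalArrowProofs
import HarnessLib

/-!
# [IUTchI] Definition 3.1 (e)/(f): the printed §1 claims for the `K`-datum descend to every LOCAL datum
# `D.peLoc k ι` — part 1: the Galois groups `Gal(X̲→/C̲)`, `Gal(C̲→/C̲)` are unchanged by base change

S. Mochizuki, *Inter-universal Teichmüller theory I*, §3, Def. 3.1 (e), (f) (kurims manuscript, May 2020, pp. 62–63)
[claim: Mochizuki2012, status: disputed]: (f) "the data `(X_K, C̲_K, ε̲)` determines … a finite étale covering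
`C̲→_K → C̲_K` of degree `l` … and, for `v ∈ V̲^good`, `Π_{X̲→_v} ⊆ Π_{C̲→_v} ⊆ Π_{C_v}`" (base change of the
cartesian diagram of §1 p. 38: "finite étale cyclic coverings … `Gal(C̲→/C̲) ≅ ℤ/lℤ`, `Gal(X̲→/C̲) ≅ ℤ/2lℤ`").

PROOF-ONLY (theorems only; no definitions, no instances), over `InitialThetaDataLocalArrowProofs` (abc-iut-L5-t2):
for the REAL Def. 3.1 datum `D`, `k = K_v̲ ⊆ Ω = k̄` Galois, `ι : F̄ → Ω`, and abc-iut-L5-t1's typed printed claims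
`hA : D.geom.pe.ArrowCoveringClaims` for the `K`-datum (a HYPOTHESIS, nothing asserted):
* `quotient_normal_relIndex_isCyclic` — for any `X₀ ⊴ Π_{C̲_K}` surjecting onto `G_K`, the base change
  `X₀ ×_{G_F} Γ ⊆ Π_{C̲_K} ×_{G_F} Γ` (any `ρ : Γ → G_F`) is normal with the SAME index and an ISOMORPHIC (hence
  equally cyclic) quotient: the comparison map `Π_{C̲,v̲} → Π_{C̲_K}/X₀`, `(embK c, σ) ↦ c`, is surjective (twist by
  `X₀ ↠ G_K`) with kernel the base change of `X₀`;
* hence, with part 2 of the transport (`peLoc_piXarrow_eq_subgroupOf`): for the LOCAL datum `D.peLoc k ι` the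
  clauses `piXarrow_normal`, `piCarrow_normal`, `piXarrow_relindex` (`= 2l`), `piCarrow_relindex` (`= l`),
  `galX_cyclic`, `galC_cyclic` of `ArrowCoveringClaims` HOLD given `hA` (`peLoc_piXarrow_normal`, …,
  `peLoc_galC_cyclic`) — "`Gal(X̲→_v̲/C̲_v̲) = Gal(X̲→_K/C̲_K) ≅ ℤ/2l`";
* helpers: `comap_subtype_PiLoc` (`Π_{H,v̲} ∩ Π_{C_v̲}` pulled back to `Π_{C_v̲}` is `fstLoc⁻¹(H)`),
  `mem_peLoc_iff_of_map_eq` (membership transfer along `T(X') = e(X)`), `map_subtype_peLoc_PiXbar`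
  (`T(Π_{X̲,v̲}) = Π_{X̲_K} ×_{G_F} Gal(Ω/k)`), `peLoc_piXarrow_eq_comap` / `peLoc_piCarrow_eq_comap`.
The remaining clauses and the assembled `(D.peLoc k ι).ArrowCoveringClaims` are part 2
(`InitialThetaDataLocalArrowClaimsAssembly`). Nothing of the series is asserted; no side is taken.
-/

noncomputable section

namespace Literature.IUT.HodgeTheaters

open Topology

universe u v w w'

namespace InitialThetaData

/-! ### Base change of a normal subgroup of `Π_{C̲_K}`: same index, isomorphic quotient -/

section General

variable {F : Type u} {K : Type v} {Fbar : Type w} [Field F] [NumberField F] [Field K] [NumberField K]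
  [Algebra F K] [Field Fbar] [Algebra F Fbar] [Algebra K Fbar]
  {E : WeierstrassCurve F} [E.IsElliptic] {l : ℕ} {Pb : BadPlacePredicates K}
  (D : InitialThetaData F K Fbar E l Pb) {Γ : Type w'} [Group Γ] (ρ : Γ →* (Fbar ≃ₐ[F] Fbar))

/-- `Π_{H,v̲}` pulled back to `Π_{H₀,v̲}` is the preimage of `H` under `Π_{H₀,v̲} → Π_{C_F}` (the augmentation condition
is automatic inside `Π_{H₀,v̲}`). [claim: Mochizuki2012, status: disputed] -/
theorem comap_subtype_PiLoc (H H₀ : Subgroup D.PiC) :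
    (D.PiLoc H ρ).comap (D.PiLoc H₀ ρ).subtype = H.comap (D.fstLoc H₀ ρ) := by
  ext z
  constructor
  · intro hz
    exact ((D.mem_PiLoc H ρ z.1).mp hz).1
  · intro hz
    exact (D.mem_PiLoc H ρ z.1).mpr ⟨hz, ((D.mem_PiLoc H₀ ρ z.1).mp z.2).2⟩

/-- **Base change of a normal subgroup `X₀ ⊴ Π_{C̲_K}` with `X₀ ↠ G_K`** (inside `Π_{C̲,v̲} := Π_{C̲_K} ×_{G_F} Γ`, any
`ρ : Γ → G_F`): `X₀ ×_{G_F} Γ` is NORMAL in `Π_{C̲,v̲}` with the SAME index `[Π_{C̲,v̲} : X₀ ×_{G_F} Γ] = [Π_{C̲_K} : X₀]`,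
and the quotient is cyclic if `Π_{C̲_K}/X₀` is: the comparison homomorphism `Π_{C̲,v̲} → Π_{C̲_K}/X₀`,
`(embK c, σ) ↦ c`, is surjective (twist a representative by `X₀ ↠ G_K` into the fibre over `σ = 1`) with kernel
`X₀ ×_{G_F} Γ`. [claim: Mochizuki2012, status: disputed] -/
theorem quotient_normal_relIndex_isCyclic (X₀ : Subgroup D.geom.pe.PiC) (hX₀ : X₀ ≤ D.geom.pe.PiCbar)
    [hn : (X₀.subgroupOf D.geom.pe.PiCbar).Normal]
    (haug : Function.Surjective (D.geom.pe.E.aug.toMonoidHom.comp X₀.subtype)) :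
    (((X₀.map D.geom.embK).comap (D.fstLoc D.PiCK ρ)).subgroupOf (D.PiCund.comap (D.fstLoc D.PiCK ρ))).Normal ∧
    ((X₀.map D.geom.embK).comap (D.fstLoc D.PiCK ρ)).relIndex (D.PiCund.comap (D.fstLoc D.PiCK ρ)) =
      X₀.relIndex D.geom.pe.PiCbar ∧
    (IsCyclic (D.geom.pe.PiCbar ⧸ X₀.subgroupOf D.geom.pe.PiCbar) →
      ∀ [(((X₀.map D.geom.embK).comap (D.fstLoc D.PiCK ρ)).subgroupOf
          (D.PiCund.comap (D.fstLoc D.PiCK ρ))).Normal],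
        IsCyclic (D.PiCund.comap (D.fstLoc D.PiCK ρ) ⧸
          ((X₀.map D.geom.embK).comap (D.fstLoc D.PiCK ρ)).subgroupOf (D.PiCund.comap (D.fstLoc D.PiCK ρ)))) := by
  -- the comparison homomorphism `ψ : Π_{C̲,v̲} → Π_{C̲_K} / X₀`
  let f := D.fstLoc D.PiCK ρ
  let Y' : Subgroup (D.PiLoc D.PiCK ρ) := D.PiCund.comap f
  let X' : Subgroup (D.PiLoc D.PiCK ρ) := (X₀.map D.geom.embK).comap f
  let eC : D.geom.pe.PiCbar ≃* D.PiCund :=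
    D.geom.pe.PiCbar.equivMapOfInjective D.geom.embK D.geom.embK_injective
  let ψ : Y' →* D.geom.pe.PiCbar ⧸ X₀.subgroupOf D.geom.pe.PiCbar :=
    (QuotientGroup.mk' _).comp (eC.symm.toMonoidHom.comp (f.subgroupComap D.PiCund))
  have heC : ∀ z : D.PiCund, D.geom.embK ((eC.symm z : D.geom.pe.PiCbar) : D.geom.pe.PiC) = (z : D.PiC) := by
    intro z
    have h := Subgroup.coe_equivMapOfInjective_apply D.geom.pe.PiCbar D.geom.embK D.geom.embK_injective
      (eC.symm z)
    rw [show D.geom.pe.PiCbar.equivMapOfInjective D.geom.embK D.geom.embK_injective (eC.symm z) = z from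
      eC.apply_symm_apply z] at h
    exact h.symm
  have hψ : ∀ y : Y', ψ y = QuotientGroup.mk (eC.symm (f.subgroupComap D.PiCund y)) := fun _ => rfl
  -- kernel
  have hker : ψ.ker = X'.subgroupOf Y' := by
    ext y
    rw [MonoidHom.mem_ker, hψ, QuotientGroup.eq_one_iff, Subgroup.mem_subgroupOf, Subgroup.mem_subgroupOf]
    change _ ↔ f (y : D.PiLoc D.PiCK ρ) ∈ X₀.map D.geom.embK
    constructor
    · intro h
      exact ⟨_, h, heC _⟩
    · rintro ⟨x, hx, hxe⟩
      have hval : (eC.symm (f.subgroupComap D.PiCund y) : D.geom.pe.PiCbar) = ⟨x, hX₀ hx⟩ := by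
        apply Subtype.ext
        apply D.geom.embK_injective
        rw [heC]
        exact hxe.symm
      rw [hval]
      exact hx
  -- surjectivity
  have hsurj : Function.Surjective ψ := by
    intro q
    obtain ⟨c, rfl⟩ := QuotientGroup.mk_surjective q
    obtain ⟨p, hp⟩ := haug (D.geom.pe.E.aug (c : D.geom.pe.PiC))⁻¹
    have hc' : (c : D.geom.pe.PiC) * p ∈ D.geom.pe.PiCbar := D.geom.pe.PiCbar.mul_mem c.2 (hX₀ p.2)
    have haug1 : D.geom.pe.E.aug ((c : D.geom.pe.PiC) * p) = 1 := by
      rw [map_mul]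
      change _ * (D.geom.pe.E.aug.toMonoidHom.comp X₀.subtype) p = 1
      rw [hp, mul_inv_cancel]
    have hΔ : D.geom.embK ((c : D.geom.pe.PiC) * p) ∈ D.DeltaC :=
      (D.embK_mem_deltaC_iff _).mpr (D.geom.pe.E.mem_geom.mpr haug1)
    have hP : (D.geom.embK ((c : D.geom.pe.PiC) * p), (1 : Γ)) ∈ D.PiLoc D.PiCK ρ :=
      (D.mem_PiLoc _ _ _).mpr ⟨⟨_, rfl⟩, by rw [map_one, D.augGF_eq_one_iff]; exact hΔ⟩
    have hY : (⟨_, hP⟩ : D.PiLoc D.PiCK ρ) ∈ Y' := ⟨_, hc', rfl⟩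
    refine ⟨⟨_, hY⟩, ?_⟩
    have hval : (eC.symm (f.subgroupComap D.PiCund ⟨⟨_, hP⟩, hY⟩) : D.geom.pe.PiCbar) =
        ⟨(c : D.geom.pe.PiC) * p, hc'⟩ := by
      apply Subtype.ext
      apply D.geom.embK_injective
      rw [heC]
      rfl
    rw [hψ, hval, QuotientGroup.eq, Subgroup.mem_subgroupOf]
    change ((c : D.geom.pe.PiC) * p)⁻¹ * (c : D.geom.pe.PiC) ∈ X₀
    rw [mul_inv_rev, inv_mul_cancel_right]
    exact X₀.inv_mem p.2
  have hnorm : (X'.subgroupOf Y').Normal := by rw [← hker]; infer_instance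
  refine ⟨hnorm, ?_, ?_⟩
  · -- index
    change (X'.subgroupOf Y').index = (X₀.subgroupOf D.geom.pe.PiCbar).index
    rw [← hker, Subgroup.index_ker, MonoidHom.range_eq_top.mpr hsurj, Subgroup.card_top, Subgroup.index]
  · -- cyclicity
    intro hcyc _
    haveI := hcyc
    let e : D.geom.pe.PiCbar ⧸ X₀.subgroupOf D.geom.pe.PiCbar ≃* Y' ⧸ X'.subgroupOf Y' :=
      (QuotientGroup.quotientKerEquivOfSurjective ψ hsurj).symm.trans (QuotientGroup.quotientMulEquivOfEq hker)
    exact isCyclic_of_surjective e e.surjective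

end General

/-! ### The local datum: `Π_{X̲→}`, `Π_{C̲→}` normal in `Π_{C̲,v̲}` with the same cyclic quotients -/

section PeLoc

variable {F : Type u} {K : Type v} {Fbar : Type w} [Field F] [NumberField F] [Field K] [NumberField K]
  [Algebra F K] [Field Fbar] [Algebra F Fbar] [Algebra K Fbar] [IsScalarTower F K Fbar] [Normal K Fbar]
  [Algebra.IsIntegral F Fbar]
  {E : WeierstrassCurve F} [E.IsElliptic] {l : ℕ} {Pb : BadPlacePredicates K}
  (D : InitialThetaData F K Fbar E l Pb)
  {Ω : Type w} [Field Ω] [Algebra K Ω]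
  (k : Type w) [Field k] [Algebra K k] [Algebra k Ω] [IsScalarTower K k Ω] [IsGalois k Ω] (ι : Fbar →ₐ[K] Ω)

/-- Membership transfer along `T(X') = e(X)`: `x ∈ X' ↔ ↑x = e(y)` for some `y ∈ X`. [claim: Mochizuki2012, status: disputed] -/
theorem mem_peLoc_iff_of_map_eq {X' : Subgroup (D.peLoc k ι).PiC} {X : Subgroup D.geom.pe.PiC}
    (h : Subgroup.map (G := (D.peLoc k ι).PiC) (D.PiLoc D.PiCK (localToGF F k ι)).subtype X' =
      X.map (D.embLoc k))
    (x : (D.peLoc k ι).PiC) :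
    x ∈ X' ↔ ∃ y ∈ X, D.embLoc k y = (D.PiLoc D.PiCK (localToGF F k ι)).subtype x := by
  constructor
  · intro hx
    exact h.le ⟨x, hx, rfl⟩
  · rintro ⟨y, hy, hye⟩
    obtain ⟨x', hx', hxe⟩ := h.ge ⟨y, hy, hye⟩
    obtain rfl : x' = x := (D.PiLoc D.PiCK (localToGF F k ι)).subtype_injective hxe
    exact hx'

/-- `T(Π_{X̲,v̲}) = Π_{X̲_K} ×_{G_F} Gal(Ω/k)` (`Π_{X̲,v̲} = Π_{X,v̲} ∩ Π_{C̲,v̲}`; `Π_{X̲_K} = Π_{X_K} ∩ Π_{C̲_K}`).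
[claim: Mochizuki2012, status: disputed] -/
theorem map_subtype_peLoc_PiXbar :
    Subgroup.map (G := (D.peLoc k ι).PiC) (D.PiLoc D.PiCK (localToGF F k ι)).subtype (D.peLoc k ι).PiXbar =
      D.PiLoc D.PiXund (localToGF F k ι) := by
  rw [PuncturedEllipticData.PiXbar, Subgroup.map_inf_eq (D.peLoc k ι).PiX (D.peLoc k ι).PiCbar,
    map_subtype_peLoc_PiX, map_subtype_peLoc_PiCbar, ← PiLoc_inf]
  · congr 1
    refine le_antisymm ?_ (le_inf D.PiXund_le_PiXK D.PiXund_le_PiCund)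
    rintro x ⟨hxX, hxC⟩
    obtain ⟨c, hc, rfl⟩ := hxC
    have hcX : c ∈ D.geom.pe.PiX := (D.embK_mem_PiX_iff c).mp (Subgroup.mem_inf.mp hxX).1
    exact ⟨c, Subgroup.mem_inf.mpr ⟨hcX, hc⟩, rfl⟩
  · exact (D.PiLoc D.PiCK (localToGF F k ι)).subtype_injective

/-- `Π_{X̲→}(C_v̲) = fstLoc⁻¹(Π_{X̲→_K})` inside `Π_{C_v̲}`, given the §1 claims. [claim: Mochizuki2012, status: disputed] -/
theorem peLoc_piXarrow_eq_comap (hA : D.geom.pe.ArrowCoveringClaims) :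
    (D.peLoc k ι).piXarrow = D.PiXarrow.comap (D.fstLoc D.PiCK (localToGF F k ι)) := by
  rw [D.peLoc_piXarrow_eq_subgroupOf k ι hA]
  exact D.comap_subtype_PiLoc _ _ _

/-- `Π_{C̲→}(C_v̲) = fstLoc⁻¹(Π_{C̲→_K})` inside `Π_{C_v̲}`, given the §1 claims. [claim: Mochizuki2012, status: disputed] -/
theorem peLoc_piCarrow_eq_comap (hA : D.geom.pe.ArrowCoveringClaims) :
    (D.peLoc k ι).piCarrow = D.PiCarrow.comap (D.fstLoc D.PiCK (localToGF F k ι)) := by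
  rw [D.peLoc_piCarrow_eq_subgroupOf k ι hA]
  exact D.comap_subtype_PiLoc _ _ _

/-- **Local `piXarrow_normal`, `piXarrow_relindex`, `galX_cyclic`** from the `K`-level claims: `Π_{X̲→}(C_v̲) ⊴ Π_{C̲,v̲}`
with index `2l` and cyclic quotient (`Gal(X̲→_v̲/C̲_v̲) = Gal(X̲→_K/C̲_K) ≅ ℤ/2l`). [claim: Mochizuki2012, status: disputed] -/
theorem peLoc_galX (hA : D.geom.pe.ArrowCoveringClaims) :
    ((D.peLoc k ι).piXarrow.subgroupOf (D.peLoc k ι).PiCbar).Normal ∧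
    (D.peLoc k ι).piXarrow.relIndex (D.peLoc k ι).PiCbar = 2 * (D.peLoc k ι).l ∧
    ∀ [((D.peLoc k ι).piXarrow.subgroupOf (D.peLoc k ι).PiCbar).Normal],
      IsCyclic ((D.peLoc k ι).PiCbar ⧸ (D.peLoc k ι).piXarrow.subgroupOf (D.peLoc k ι).PiCbar) := by
  haveI := hA.piXarrow_normal
  obtain ⟨hn, hidx, hcyc⟩ := D.quotient_normal_relIndex_isCyclic (localToGF F k ι) D.geom.pe.piXarrow
    D.geom.pe.piXarrow_le_piCbar D.geom.pe.aug_piXarrow_surjective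
  have hX : (D.peLoc k ι).piXarrow = (D.geom.pe.piXarrow.map D.geom.embK).comap (D.fstLoc D.PiCK (localToGF F k ι)) :=
    D.peLoc_piXarrow_eq_comap k ι hA
  rw [hX]
  refine ⟨hn, hidx.trans ?_, fun {_} => hcyc hA.galX_cyclic⟩
  rw [hA.piXarrow_relindex]
  rfl

/-- **Local `piCarrow_normal`, `piCarrow_relindex`, `galC_cyclic`** from the `K`-level claims: `Π_{C̲→}(C_v̲) ⊴ Π_{C̲,v̲}`
with index `l` and cyclic quotient (`Gal(C̲→_v̲/C̲_v̲) = Gal(C̲→_K/C̲_K) ≅ ℤ/l`). [claim: Mochizuki2012, status: disputed] -/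
theorem peLoc_galC (hA : D.geom.pe.ArrowCoveringClaims) :
    ((D.peLoc k ι).piCarrow.subgroupOf (D.peLoc k ι).PiCbar).Normal ∧
    (D.peLoc k ι).piCarrow.relIndex (D.peLoc k ι).PiCbar = (D.peLoc k ι).l ∧
    ∀ [((D.peLoc k ι).piCarrow.subgroupOf (D.peLoc k ι).PiCbar).Normal],
      IsCyclic ((D.peLoc k ι).PiCbar ⧸ (D.peLoc k ι).piCarrow.subgroupOf (D.peLoc k ι).PiCbar) := by
  haveI := hA.piCarrow_normal
  obtain ⟨hn, hidx, hcyc⟩ := D.quotient_normal_relIndex_isCyclic (localToGF F k ι) D.geom.pe.piCarrow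
    D.geom.pe.piCarrow_le_piCbar D.geom.pe.aug_piCarrow_surjective
  have hX : (D.peLoc k ι).piCarrow = (D.geom.pe.piCarrow.map D.geom.embK).comap (D.fstLoc D.PiCK (localToGF F k ι)) :=
    D.peLoc_piCarrow_eq_comap k ι hA
  rw [hX]
  refine ⟨hn, hidx.trans ?_, fun {_} => hcyc hA.galC_cyclic⟩
  rw [hA.piCarrow_relindex]
  rfl

end PeLoc

end InitialThetaData

end Literature.IUT.HodgeTheaters

end
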